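import Summits.Ventures.CertifiedArithmetic.LowPrec.GemmThetaLawGenE3M2Data

/-!
# E3M2×E3M2 law check, part 6/11: `bin 6` (sign −), `bin 7`

HONEST FRAMING (venture CertifiedArithmetic / cell `pub-lowprec`, seat gemm, gen 13): certified
error envelopes and provably optimal rounding/accumulation schemes for low-precision formats under
stated cost models; every table by two implementations; no hardware or vendor claims.

Part 6/11 of the per-level kernel check of `e3m2Law.lawCheck` (see
`GemmThetaLawGenE3M2Data.lean`): `bin 6` (sign −), `bin 7` (1201 + 2302 classes; a level above
2400 classes is split by sign, the two halves are joined in `GemmThetaLawGenE3M2.lean`). [cell]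
-/

namespace Literature.ComputerArithmetic.FloatingPoint

namespace MiniFloat

namespace ThetaLaw

/-- Level `bin 6`, sign `−`, of the E3M2×E3M2 law check: all classes pass and cover (1201 of the
level's 2402 classes, all 291 letters). [cell, kernel `decide`] -/
theorem levCheck_e3m2_b6_neg :
    (e3m2Law.lam.all fun q =>
      (e3m2Law.mainClasses (Lev.bin 6) (-1) q).all e3m2Law.clsOK &&
        e3m2Law.coverOK (Lev.bin 6) (-1) q) = true := by
  decide +kernel

/-- Level `bin 7` of the E3M2×E3M2 law check passes (2302 classes, both signs, all 291 letters).
[cell, kernel `decide`] -/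
theorem levCheck_e3m2_b7 : e3m2Law.levCheck (Lev.bin 7) = true := by
  decide +kernel

end ThetaLaw

end MiniFloat

end Literature.ComputerArithmetic.FloatingPoint
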